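import Summits.ValiantsHypothesis.ValiantsHypothesis.Theorems.DefinabilityGapAffineRung
import Mathlib.Analysis.SpecialFunctions.Exp
import HarnessLib

/-!
# Definability gap, ROAD P: asymptotics and the arithmetic of the constants (N1 v2 (5n), part 1)

Generic tools and the NAT-arithmetic side conditions for the numeric lemma `∃ m₀` that
discharges the hypotheses of `DefinabilityGapPhaseAExists.exists_rowRule_fewBad_clauses`
(PLAN-N1-v2 TODO (5n)).  Constants (functions of `m`): `kC m = m/4 + 1` (excluded heavy rows),
`NC m = 32 m` (heavy threshold), `MC m = (m − kC m)/16` (light threshold of the good lines),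
`LC m = m/8`, `BC = 2400` (free positions wanted per line).

* `tendsto_const_mul_pow_mul_exp_neg`, `eventually_const_mul_pow_mul_exp_neg_lt`:
  `C m^k e^{−a m} → 0`;
* `card_bound`: `2 (2 q + 1) ≤ 8 m² + 10` (Bertrand, `leastPrimeGe_le`);
* `hk_holds`: `2 (2q+1) ≤ NC m · kC m`; `kC_lt`; `sub_kC_ge`; `MC_pos`; `hMLB_holds`:
  `2 (2q+1) ≤ MC m · LC m · BC` for `m ≥ 128`; `hn₀_holds`: `m/2 + BC ≤ m + 1` for `m ≥ 4800`.
-/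

namespace Summit.ValiantsHypothesis.ValiantsHypothesis.Theorems.DefinabilityGapAsymptotics

open Filter Topology Real
open Literature.Computability.AlgebraicComplexity Literature.Computability.MetaComplexity
open Summit.ValiantsHypothesis.ValiantsHypothesis.Theorems.DefinabilityGapAffineRung

/-! ## 1. Exponential decay beats polynomial growth -/

/-- `C · m^k · e^{−a m} → 0` along the naturals (`a > 0`). [this file] -/
theorem tendsto_const_mul_pow_mul_exp_neg (k : ℕ) {a : ℝ} (ha : 0 < a) (C : ℝ) :
    Tendsto (fun m : ℕ => C * (m : ℝ) ^ k * exp (-(a * m))) atTop (𝓝 0) := by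
  have h1 : Tendsto (fun m : ℕ => a * (m : ℝ)) atTop atTop :=
    Tendsto.const_mul_atTop ha tendsto_natCast_atTop_atTop
  have h2 := (Real.tendsto_pow_mul_exp_neg_atTop_nhds_zero k).comp h1
  have h3 := h2.const_mul (C * a⁻¹ ^ k)
  rw [mul_zero] at h3
  refine h3.congr fun m => ?_
  have hk : a⁻¹ ^ k * a ^ k = 1 := by rw [← mul_pow, inv_mul_cancel₀ ha.ne', one_pow]
  simp only [Function.comp_def]
  calc C * a⁻¹ ^ k * ((a * (m : ℝ)) ^ k * exp (-(a * m)))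
      = C * (a⁻¹ ^ k * a ^ k) * (m : ℝ) ^ k * exp (-(a * m)) := by rw [mul_pow]; ring
    _ = C * (m : ℝ) ^ k * exp (-(a * m)) := by rw [hk, mul_one]

/-- Eventually `C · m^k · e^{−a m} < ε`. [this file] -/
theorem eventually_const_mul_pow_mul_exp_neg_lt (k : ℕ) {a : ℝ} (ha : 0 < a) (C : ℝ) {ε : ℝ}
    (hε : 0 < ε) : ∀ᶠ m : ℕ in atTop, C * (m : ℝ) ^ k * exp (-(a * m)) < ε :=
  (tendsto_const_mul_pow_mul_exp_neg k ha C).eventually (gt_mem_nhds hε)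

/-- A shifted version: eventually `C · m^k · e^{b − a m} < ε`. [this file] -/
theorem eventually_const_mul_pow_mul_exp_sub_lt (k : ℕ) {a : ℝ} (ha : 0 < a) (C b : ℝ) {ε : ℝ}
    (hε : 0 < ε) : ∀ᶠ m : ℕ in atTop, C * (m : ℝ) ^ k * exp (b - a * m) < ε := by
  refine (eventually_const_mul_pow_mul_exp_neg_lt k ha (C * exp b) hε).mono fun m hm => ?_
  have : C * (m : ℝ) ^ k * exp (b - a * m) = C * exp b * (m : ℝ) ^ k * exp (-(a * m)) := by
    rw [sub_eq_add_neg, Real.exp_add]; ring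
  rwa [this]

/-! ## 2. The constants and their arithmetic -/

/-- Excluded rows: `k = m/4 + 1`. [this file] -/
def kC (m : ℕ) : ℕ := m / 4 + 1

/-- Heavy threshold: `N = 32 m`. [this file] -/
def NC (m : ℕ) : ℕ := 32 * m

/-- Light threshold of the good lines: `M = (m − k)/16` (so that `p m M ≤ m/16`). [this file] -/
def MC (m : ℕ) : ℕ := (m - kC m) / 16

/-- Bad-line parameter: `L = m/8`. [this file] -/
def LC (m : ℕ) : ℕ := m / 8

/-- Free positions wanted per line: `B = 2400`. [this file] -/
def BC : ℕ := 2400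

/-- The size bound: `2 (2q + 1) ≤ 8 m² + 10` (Bertrand). [this file] -/
theorem card_bound (m : ℕ) : 2 * (2 * qOf m + 1) ≤ 8 * (m * m) + 10 := by
  have hq : qOf m ≤ 2 * (m * m + 1) := leastPrimeGe_le _ (by omega)
  omega

/-- `2 (2q+1) ≤ N k`. [this file] -/
theorem hk_holds {m : ℕ} (hm : 2 ≤ m) : 2 * (2 * qOf m + 1) ≤ NC m * kC m := by
  have h := card_bound m
  have h4 : m ≤ 4 * (m / 4) + 3 := by omega
  unfold NC kC
  nlinarith [h, h4, Nat.zero_le (m / 4)]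

/-- `k < m` for `m ≥ 2`. [this file] -/
theorem kC_lt {m : ℕ} (hm : 2 ≤ m) : kC m < m := by
  unfold kC; omega

/-- `2 k ≤ m` for `m ≥ 4` (so that `p = 1/(m−k) ≤ 2/m`). [this file] -/
theorem two_kC_le {m : ℕ} (hm : 4 ≤ m) : 2 * kC m ≤ m := by
  unfold kC; omega

/-- `16 ≤ m − k` for `m ≥ 24` (so that `M ≥ 1` and `p ≤ 1/2`). [this file] -/
theorem sub_kC_ge {m : ℕ} (hm : 24 ≤ m) : 16 ≤ m - kC m := by
  unfold kC; omega

/-- `0 < M` for `m ≥ 24`. [this file] -/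
theorem MC_pos {m : ℕ} (hm : 24 ≤ m) : 0 < MC m := by
  have := sub_kC_ge hm
  unfold MC; omega

/-- `16 M ≤ m − k` (so that `p m M ≤ m/16`). [this file] -/
theorem sixteen_MC_le (m : ℕ) : 16 * MC m ≤ m - kC m := by
  unfold MC; omega

/-- `2 (2q+1) ≤ M L B` for `m ≥ 128`. [this file] -/
theorem hMLB_holds {m : ℕ} (hm : 128 ≤ m) : 2 * (2 * qOf m + 1) ≤ MC m * LC m * BC := by
  have h := card_bound m
  have hM : 3 * m ≤ 64 * MC m + 64 := by unfold MC kC; omega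
  have hL : m ≤ 8 * LC m + 7 := by unfold LC; omega
  have hM' : 16 * MC m ≤ m := by unfold MC kC; omega
  have hL' : 8 * LC m ≤ m := by unfold LC; omega
  unfold BC
  nlinarith [h, hM, hL, hM', hL', Nat.zero_le (MC m), Nat.zero_le (LC m)]

/-- `n₀ + B ≤ m + 1` with `n₀ = m/2`, for `m ≥ 4800`. [this file] -/
theorem hn₀_holds {m : ℕ} (hm : 4800 ≤ m) : m / 2 + BC ≤ m + 1 := by
  unfold BC; omega

end Summit.ValiantsHypothesis.ValiantsHypothesis.Theorems.DefinabilityGapAsymptotics
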